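import Summits.Ventures.LatticeQCDFlow.Exactness.IMHColdStartMultiTime
import Literature.Probability.MarkovChains.DoeblinMinorization
import HarnessLib

/-!
# Every start: the exact Doeblin split of flow-MCMC — `μ₀Kⁿ = (1 − rⁿ)·π + rⁿ·μ₀Rⁿ` for EVERY initial law

HONEST FRAMING: exact (Metropolis-corrected) sampling algorithms for lattice gauge theory;
figures of merit are autocorrelation/cost numbers at stated couplings and volumes; no
continuum-physics claim.

Venture `LatticeQCDFlow` (cell pub-lqcd), topic `Exactness`; FANOUT row 30 (lean-1, GEN-34).  NEW WORK of the
cell, general state space.  GEN-31–33 computed the flow-MCMC chain `K = indepMH q w` (proposal `q`, normalised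
weight `w = dπ/dq`, `π = w·q`) started AT A MODE `x₀` of `w` through the two-point structure
`δ_{x₀}K = A·π + (1 − A)·δ_{x₀}` (`A = 1/w(x₀)` the acceptance mass at the mode, `r = 1 − A`;
`Exactness/IMHModeRenewal`).  Every "NOT CLAIMED: non-modal starts" of those files is removed here at the level
of ONE-TIME LAWS: the tree's minorisation `K(x, ·) ≥ A·π` FOR EVERY STATE `x` (`IMHKernel.indepMH_apply_ge` with
the bound `w ≤ w(x₀)`) is Doeblin's condition with the EXACT constant `A`, and the residual kernel
`R = (K − A·π)/(1 − A)` of `Literature/Probability/MarkovChains/DoeblinMinorization` (Meyn–Tweedie's split,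
a reviewed Literature definition — nothing new is defined here) carries the rest:

* §1 **`indepMH_minorised_mode`** — `A·π(B) ≤ K(x, B)` for all `x`, `B`; **`bind_residual_indepMH_target`** —
  `πR = π` (the target is invariant for the residual chain too); **`residual_indepMH_mode`** — `R(x₀, ·) = δ_{x₀}`:
  THE RESIDUAL CHAIN NEVER LEAVES THE MODE — GEN-31's renewal `δ_{x₀}K = A·π + (1 − A)·δ_{x₀}` is the row of
  the split at `x₀`.
* §2 **`iterate_bind_indepMH_eq_residual_mixture`** — FOR EVERY INITIAL LAW `μ₀` (a hot start drawn from the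
  flow, a checkpoint of another run, any mixture) and every `n`:
  `μ₀Kⁿ = (1 − rⁿ)·π + rⁿ·μ₀Rⁿ` EXACTLY (`w(x₀) > 1`; induction with `πK = π`); at `μ₀ = δ_{x₀}` this is GEN-31's
  `(1 − rⁿ)·π + rⁿ·δ_{x₀}` (**`iterate_bind_residual_dirac_mode`**: `δ_{x₀}Rⁿ = δ_{x₀}`); and for every `w(x₀) ≥ 1`
  the `R`-free form **`exists_iterate_bind_indepMH_eq_mixture`**: `μ₀Kⁿ = (1 − rⁿ)·π + rⁿ·ν` for SOME probability
  law `ν`.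
* §3 consequences for every measurable `B` and every start: **`iterate_bind_indepMH_real_ge`** —
  THE LOWER ENVELOPE `μ₀Kⁿ(B) ≥ (1 − rⁿ)·π(B)` (after `n` updates at least the fraction `1 − rⁿ` of the law IS
  the target, whatever the start); **`iterate_bind_indepMH_real_le`** — `μ₀Kⁿ(B) ≤ (1 − rⁿ)·π(B) + rⁿ`;
  **`iterate_bind_indepMH_real_sub_mem_Icc`** — `μ₀Kⁿ(B) − π(B) ∈ [−rⁿ·π(B), rⁿ·(1 − π(B))]`, so
  (**`iterate_bind_indepMH_real_sub_abs_le`**) `|μ₀Kⁿ(B) − π(B)| ≤ rⁿ·max(π(B), 1 − π(B))` (`≤ rⁿ`, the tree's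
  Doeblin rate `IMHModeRateSharp.indepMH_uniform_rate_of_mode`, with the one-sided information kept).
* §4 observables: **`integral_iterate_bind_indepMH_mem_Icc`** — for measurable `f` with `a ≤ f ≤ b`:
  `E_{μ₀}[f(X_n)] − π(f) ∈ [rⁿ·(a − π(f)), rⁿ·(b − π(f))]` from every start (the cold start gives exactly
  `rⁿ·(f(x₀) − π(f))`, GEN-31: the envelope is attained by a modal start whenever `f(x₀) ∈ {a, b}`), and
  **`integral_iterate_bind_indepMH_abs_le`** — `|E_{μ₀}[f(X_n)] − π(f)| ≤ rⁿ·(b − a)`.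

Reading (for `Scaling/AutoregressiveGauge…AnyStart`): an exact gauge sampler started from ANY configuration law (e.g.
a fresh draw of its own autoregressive proposal) is after `n` updates an exact `(1 − (1 − A)ⁿ, (1 − A)ⁿ)` mixture of
the target and a residual law; every observable's start-up bias is at most `(1 − A)ⁿ` times its range.
NOT CLAIMED: the residual law `μ₀Rⁿ` of a particular non-modal start (no closed form); path-space statements (next
file `Exactness/IMHAnyStartPathSplit`); anything for `w(x₀) = 1` beyond the `R`-free form (then the sampler is i.i.d.).
No `sorry`, no new definitions, nothing cited as a fact (the residual kernel is the tree's Literature definition).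
-/

noncomputable section

namespace Summit.Ventures.LatticeQCDFlow.Exactness

open MeasureTheory ProbabilityTheory Function
open scoped ENNReal
open Literature.Probability.MarkovChains

variable {Ω : Type*} [MeasurableSpace Ω] {q : Measure Ω} [IsProbabilityMeasure q] {w : Ω → ℝ}

/-! ## §1 The exact minorisation at a mode and the residual kernel -/

/-- **Doeblin's condition with the exact constant**: for `w` measurable, positive, maximal at `x₀`,
`(1/w(x₀))·π(B) ≤ K(x, B)` for every state `x` and measurable `B` (`IMHKernel.indepMH_apply_ge` at `M = w(x₀)`).
[ours, bookkeeping] -/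
theorem indepMH_minorised_mode (hw : Measurable w) (hw0 : ∀ y, 0 < w y) {x₀ : Ω} (hmax : ∀ y, w y ≤ w x₀) :
    ∀ x {B : Set Ω}, MeasurableSet B →
      ENNReal.ofReal (w x₀)⁻¹ * (q.withDensity fun y => ENNReal.ofReal (w y)) B ≤ indepMH q w x B := by
  intro x B hB
  rw [ENNReal.ofReal_inv_of_pos (hw0 x₀)]
  exact indepMH_apply_ge hw hw0 hmax x hB

omit [MeasurableSpace Ω] in
/-- `1 − ofReal(1/w(x₀)) = ofReal(1 − 1/w(x₀))`. [ours, bookkeeping] -/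
theorem one_sub_ofReal_inv_eq (hw0 : ∀ y, 0 < w y) (x₀ : Ω) :
    (1 : ℝ≥0∞) - ENNReal.ofReal (w x₀)⁻¹ = ENNReal.ofReal (1 - (w x₀)⁻¹) := by
  rw [ENNReal.ofReal_sub 1 (inv_nonneg.mpr (hw0 x₀).le), ENNReal.ofReal_one]

omit [MeasurableSpace Ω] in
/-- `ofReal(1/w(x₀)) < 1` when `1 < w(x₀)`. [ours, bookkeeping] -/
theorem ofReal_inv_lt_one_of_one_lt {x₀ : Ω} (hlt : 1 < w x₀) : ENNReal.ofReal (w x₀)⁻¹ < 1 := by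
  rw [← ENNReal.ofReal_one]
  exact (ENNReal.ofReal_lt_ofReal_iff zero_lt_one).2 (inv_lt_one_of_one_lt₀ hlt)

/-- **The target is invariant for the residual chain**: `πR = π` (from `πK = π = A·π + (1 − A)·πR` and
`A < 1`). [ours] -/
theorem bind_residual_indepMH_target [Fact (Measurable w)] (hw0 : ∀ y, 0 < w y) {x₀ : Ω}
    (hmax : ∀ y, w y ≤ w x₀) (hlt : 1 < w x₀)
    [IsProbabilityMeasure (q.withDensity fun y => ENNReal.ofReal (w y))] :
    (q.withDensity fun y => ENNReal.ofReal (w y)).bind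
        (Doeblin.residualKernel (indepMH q w) (q.withDensity fun y => ENNReal.ofReal (w y))
          (ENNReal.ofReal (w x₀)⁻¹) (indepMH_minorised_mode Fact.out hw0 hmax)) =
      q.withDensity fun y => ENNReal.ofReal (w y) := by
  set π : Measure Ω := q.withDensity fun y => ENNReal.ofReal (w y) with hπ
  set ε : ℝ≥0∞ := ENNReal.ofReal (w x₀)⁻¹ with hε
  have hε1 : ε < 1 := ofReal_inv_lt_one_of_one_lt hlt
  haveI := Doeblin.isMarkovKernel_residualKernel (κ := indepMH q w) (ν := π) (ε := ε)
    (hmin := indepMH_minorised_mode Fact.out hw0 hmax) hε1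
  set R := Doeblin.residualKernel (indepMH q w) π ε (indepMH_minorised_mode Fact.out hw0 hmax) with hR
  haveI : IsProbabilityMeasure (π.bind R) :=
    ⟨by rw [Measure.bind_apply MeasurableSet.univ (Kernel.aemeasurable _)]; simp⟩
  have hinv : π.bind (indepMH q w) = π := (indepMH_invariant (q := q) Fact.out hw0).def
  have hsplit := Doeblin.bind_eq_add_residual (κ := indepMH q w) (ν := π) (ε := ε)
    (hmin := indepMH_minorised_mode Fact.out hw0 hmax) hε1 π
  rw [hinv] at hsplit
  -- `π = ε π + (1 − ε) πR` set-wise; cancel `ε π(B) < ∞` against `π(B) = ε π(B) + (1 − ε) π(B)`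
  have h1e : 1 - ε ≠ 0 := (tsub_pos_of_lt hε1).ne'
  have h1t : 1 - ε ≠ ⊤ := ne_top_of_le_ne_top ENNReal.one_ne_top tsub_le_self
  ext B hB
  have h := congrArg (fun m : Measure Ω => m B) hsplit
  simp only [Measure.add_apply, Measure.smul_apply, smul_eq_mul] at h
  have hsum : ε * π B + (1 - ε) * π B = π B := by
    rw [← add_mul, add_tsub_cancel_of_le hε1.le, one_mul]
  nth_rewrite 1 [← hsum] at h
  have hεB : ε * π B ≠ ⊤ := ENNReal.mul_ne_top ENNReal.ofReal_ne_top (measure_ne_top _ _)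
  have h2 : (1 - ε) * π B = (1 - ε) * (π.bind R) B := (ENNReal.add_right_inj hεB).1 h
  exact ((ENNReal.mul_right_inj h1e h1t).1 h2).symm

/-- **The residual chain never leaves the mode**: `R(x₀, ·) = δ_{x₀}` (`K(x₀, ·) = A·π + (1 − A)·δ_{x₀}`,
GEN-31's `indepMH_mode_eq`). [ours] -/
theorem residual_indepMH_mode [Fact (Measurable w)] (hw0 : ∀ y, 0 < w y) {x₀ : Ω}
    (hmax : ∀ y, w y ≤ w x₀) (hlt : 1 < w x₀)
    [IsProbabilityMeasure (q.withDensity fun y => ENNReal.ofReal (w y))] :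
    (Doeblin.residualKernel (indepMH q w) (q.withDensity fun y => ENNReal.ofReal (w y))
        (ENNReal.ofReal (w x₀)⁻¹) (indepMH_minorised_mode Fact.out hw0 hmax)) x₀ = Measure.dirac x₀ := by
  set π : Measure Ω := q.withDensity fun y => ENNReal.ofReal (w y) with hπ
  set ε : ℝ≥0∞ := ENNReal.ofReal (w x₀)⁻¹ with hε
  have hε1 : ε < 1 := ofReal_inv_lt_one_of_one_lt hlt
  have h1e : 1 - ε ≠ 0 := (tsub_pos_of_lt hε1).ne'
  have h1t : 1 - ε ≠ ⊤ := ne_top_of_le_ne_top ENNReal.one_ne_top tsub_le_self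
  ext B hB
  rw [Doeblin.residualKernel_apply x₀ hB, indepMH_mode_apply Fact.out hw0 hmax hB, ← hε,
    ENNReal.add_sub_cancel_left (ENNReal.mul_ne_top ENNReal.ofReal_ne_top (measure_ne_top _ _)),
    ← one_sub_ofReal_inv_eq hw0 x₀, ← hε, ← mul_assoc, ENNReal.inv_mul_cancel h1e h1t, one_mul,
    Measure.dirac_apply' x₀ hB]

/-! ## §2 The exact split of the iterates from every initial law -/

/-- **EVERY START, EXACTLY**: `w` measurable (a `Fact`), positive, normalised, maximal at `x₀` with `w(x₀) > 1`;
`r = 1 − 1/w(x₀)`, `R` the residual kernel of the exact minorisation `K ≥ (1/w(x₀))·π`.  For every probability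
law `μ₀` and every `n`: `μ₀Kⁿ = (1 − rⁿ)·π + rⁿ·μ₀Rⁿ`. [ours] -/
theorem iterate_bind_indepMH_eq_residual_mixture [Fact (Measurable w)] (hw0 : ∀ y, 0 < w y) {x₀ : Ω}
    (hmax : ∀ y, w y ≤ w x₀) (hlt : 1 < w x₀)
    [IsProbabilityMeasure (q.withDensity fun y => ENNReal.ofReal (w y))]
    (n : ℕ) (μ₀ : Measure Ω) [IsProbabilityMeasure μ₀] :
    (fun m : Measure Ω => m.bind (indepMH q w))^[n] μ₀ =
      ENNReal.ofReal (1 - (1 - (w x₀)⁻¹) ^ n) • (q.withDensity fun y => ENNReal.ofReal (w y)) +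
        ENNReal.ofReal ((1 - (w x₀)⁻¹) ^ n) •
          (fun m : Measure Ω => m.bind
            (Doeblin.residualKernel (indepMH q w) (q.withDensity fun y => ENNReal.ofReal (w y))
              (ENNReal.ofReal (w x₀)⁻¹) (indepMH_minorised_mode Fact.out hw0 hmax)))^[n] μ₀ := by
  set π : Measure Ω := q.withDensity fun y => ENNReal.ofReal (w y) with hπ
  set ε : ℝ≥0∞ := ENNReal.ofReal (w x₀)⁻¹ with hε
  have hε1 : ε < 1 := ofReal_inv_lt_one_of_one_lt hlt
  haveI hRm := Doeblin.isMarkovKernel_residualKernel (κ := indepMH q w) (ν := π) (ε := ε)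
    (hmin := indepMH_minorised_mode Fact.out hw0 hmax) hε1
  set R := Doeblin.residualKernel (indepMH q w) π ε (indepMH_minorised_mode Fact.out hw0 hmax) with hR
  have hW : 1 ≤ w x₀ := hlt.le
  have ha0 : 0 ≤ (w x₀)⁻¹ := inv_nonneg.mpr (hw0 x₀).le
  have hr0 : 0 ≤ 1 - (w x₀)⁻¹ := sub_nonneg.2 (inv_le_one_of_one_le₀ hW)
  have hr1 : 1 - (w x₀)⁻¹ ≤ 1 := sub_le_self _ ha0
  have hinv : π.bind (indepMH q w) = π := (indepMH_invariant (q := q) Fact.out hw0).def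
  induction n generalizing μ₀ with
  | zero => simp
  | succ n ih =>
    haveI : IsProbabilityMeasure ((fun m : Measure Ω => m.bind R)^[n] μ₀) :=
      isProbabilityMeasure_iterate_bind (κ := R) μ₀ n
    rw [Function.iterate_succ_apply', ih μ₀, Summit.Ventures.LatticeQCDFlow.Scoring.bind_add_measure,
      Measure.bind_smul, Measure.bind_smul, hinv,
      Doeblin.bind_eq_add_residual (κ := indepMH q w) (ν := π) (ε := ε)
        (hmin := indepMH_minorised_mode Fact.out hw0 hmax) hε1 ((fun m : Measure Ω => m.bind R)^[n] μ₀),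
      ← Function.iterate_succ_apply' (fun m : Measure Ω => m.bind R) n μ₀, smul_add, smul_smul, smul_smul,
      ← add_assoc, ← add_smul, hε, one_sub_ofReal_inv_eq hw0 x₀, ← ENNReal.ofReal_mul (pow_nonneg hr0 n),
      ← ENNReal.ofReal_mul (pow_nonneg hr0 n),
      ← ENNReal.ofReal_add (sub_nonneg.2 (pow_le_one₀ hr0 hr1)) (mul_nonneg (pow_nonneg hr0 n) ha0)]
    congr 3
    all_goals ring

/-- **From the mode the residual chain is frozen**: `δ_{x₀}Rⁿ = δ_{x₀}` — so at `μ₀ = δ_{x₀}` the split IS GEN-31's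
cold-start law `(1 − rⁿ)·π + rⁿ·δ_{x₀}` (`IMHModeRenewal.iterate_bind_indepMH_dirac_mode_eq`). [ours] -/
theorem iterate_bind_residual_dirac_mode [Fact (Measurable w)] (hw0 : ∀ y, 0 < w y) {x₀ : Ω}
    (hmax : ∀ y, w y ≤ w x₀) (hlt : 1 < w x₀)
    [IsProbabilityMeasure (q.withDensity fun y => ENNReal.ofReal (w y))] (n : ℕ) :
    (fun m : Measure Ω => m.bind
        (Doeblin.residualKernel (indepMH q w) (q.withDensity fun y => ENNReal.ofReal (w y))
          (ENNReal.ofReal (w x₀)⁻¹) (indepMH_minorised_mode Fact.out hw0 hmax)))^[n] (Measure.dirac x₀) =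
      Measure.dirac x₀ := by
  induction n with
  | zero => rfl
  | succ n ih =>
    rw [Function.iterate_succ_apply', ih, Measure.dirac_bind (Kernel.measurable _),
      residual_indepMH_mode hw0 hmax hlt]

/-- If the mode has weight `1` the sampler is already exact in one step: `K(x, ·) = π` for every `x`
(`K(x, ·) ≥ π` between probability laws). [ours] -/
theorem indepMH_apply_eq_target_of_mode_eq_one (hw : Measurable w) (hw0 : ∀ y, 0 < w y) {x₀ : Ω}
    (hmax : ∀ y, w y ≤ w x₀) (h1 : w x₀ = 1)
    [IsProbabilityMeasure (q.withDensity fun y => ENNReal.ofReal (w y))] (x : Ω) :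
    indepMH q w x = q.withDensity fun y => ENNReal.ofReal (w y) := by
  haveI : Fact (Measurable w) := ⟨hw⟩
  set π : Measure Ω := q.withDensity fun y => ENNReal.ofReal (w y) with hπ
  have hge : ∀ {B : Set Ω}, MeasurableSet B → π B ≤ indepMH q w x B := by
    intro B hB
    have h := indepMH_minorised_mode (q := q) hw hw0 hmax x hB
    rwa [h1, inv_one, ENNReal.ofReal_one, one_mul] at h
  ext B hB
  refine le_antisymm ?_ (hge hB)
  -- `K(x,B) = 1 − K(x,Bᶜ) ≤ 1 − π(Bᶜ) = π(B)`
  have hK : indepMH q w x B = 1 - indepMH q w x Bᶜ := by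
    rw [← prob_add_prob_compl (μ := indepMH q w x) hB, ENNReal.add_sub_cancel_right (measure_ne_top _ _)]
  have hπB : π B = 1 - π Bᶜ := by
    rw [← prob_add_prob_compl (μ := π) hB, ENNReal.add_sub_cancel_right (measure_ne_top _ _)]
  rw [hK, hπB]
  exact tsub_le_tsub_left (hge hB.compl) 1

/-- **`R`-free form, every `w(x₀) ≥ 1`**: for every initial law `μ₀` and `n` there is a probability law `ν` with
`μ₀Kⁿ = (1 − rⁿ)·π + rⁿ·ν` (`ν = μ₀Rⁿ` when `w(x₀) > 1`; when `w(x₀) = 1` the sampler is i.i.d. and `r = 0`). [ours] -/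
theorem exists_iterate_bind_indepMH_eq_mixture (hw : Measurable w) (hw0 : ∀ y, 0 < w y) {x₀ : Ω}
    (hmax : ∀ y, w y ≤ w x₀) [IsProbabilityMeasure (q.withDensity fun y => ENNReal.ofReal (w y))]
    (n : ℕ) (μ₀ : Measure Ω) [IsProbabilityMeasure μ₀] :
    ∃ ν : Measure Ω, IsProbabilityMeasure ν ∧
      (fun m : Measure Ω => m.bind (indepMH q w))^[n] μ₀ =
        ENNReal.ofReal (1 - (1 - (w x₀)⁻¹) ^ n) • (q.withDensity fun y => ENNReal.ofReal (w y)) +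
          ENNReal.ofReal ((1 - (w x₀)⁻¹) ^ n) • ν := by
  haveI : Fact (Measurable w) := ⟨hw⟩
  set π : Measure Ω := q.withDensity fun y => ENNReal.ofReal (w y) with hπ
  have hW : 1 ≤ w x₀ := one_le_of_mode (q := q) hmax
  rcases hW.lt_or_eq with hlt | h1
  · set ε : ℝ≥0∞ := ENNReal.ofReal (w x₀)⁻¹ with hε
    haveI := Doeblin.isMarkovKernel_residualKernel (κ := indepMH q w) (ν := π) (ε := ε)
      (hmin := indepMH_minorised_mode Fact.out hw0 hmax) (ofReal_inv_lt_one_of_one_lt hlt)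
    exact ⟨_, isProbabilityMeasure_iterate_bind μ₀ n, iterate_bind_indepMH_eq_residual_mixture hw0 hmax hlt n μ₀⟩
  · -- `w(x₀) = 1`: `r = 0`; for `n = 0` take `ν = μ₀`, else `μ₀Kⁿ = π` and take `ν = π`
    refine ⟨if n = 0 then μ₀ else π, by split_ifs <;> infer_instance, ?_⟩
    rcases n with _ | n
    · simp
    · have hstep : ∀ (m : Measure Ω) [IsProbabilityMeasure m], m.bind (indepMH q w) = π := by
        intro m _
        ext B hB
        rw [Measure.bind_apply hB (Kernel.aemeasurable _)]
        simp_rw [indepMH_apply_eq_target_of_mode_eq_one hw hw0 hmax h1.symm]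
        rw [lintegral_const, measure_univ, mul_one]
      haveI := isProbabilityMeasure_iterate_bind (κ := indepMH q w) μ₀ n
      rw [Function.iterate_succ_apply', hstep, ← h1]
      simp

/-! ## §3 Set-wise envelopes from every start -/

/-- **THE LOWER ENVELOPE**: `(1 − rⁿ)·π(B) ≤ μ₀Kⁿ(B)` for every start, time and set `B` (measurable or not:
outer measures). [ours] -/
theorem iterate_bind_indepMH_real_ge (hw : Measurable w) (hw0 : ∀ y, 0 < w y) {x₀ : Ω}
    (hmax : ∀ y, w y ≤ w x₀) [IsProbabilityMeasure (q.withDensity fun y => ENNReal.ofReal (w y))]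
    (n : ℕ) (μ₀ : Measure Ω) [IsProbabilityMeasure μ₀] (B : Set Ω) :
    (1 - (1 - (w x₀)⁻¹) ^ n) * (q.withDensity fun y => ENNReal.ofReal (w y)).real B ≤
      ((fun m : Measure Ω => m.bind (indepMH q w))^[n] μ₀).real B := by
  obtain ⟨ν, hν, h⟩ := exists_iterate_bind_indepMH_eq_mixture (q := q) hw hw0 hmax n μ₀
  have hW : 1 ≤ w x₀ := one_le_of_mode (q := q) hmax
  have hr0 : 0 ≤ 1 - (w x₀)⁻¹ := sub_nonneg.2 (inv_le_one_of_one_le₀ hW)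
  have hr1 : 1 - (w x₀)⁻¹ ≤ 1 := sub_le_self _ (inv_nonneg.mpr (hw0 x₀).le)
  have hc0 : 0 ≤ 1 - (1 - (w x₀)⁻¹) ^ n := sub_nonneg.2 (pow_le_one₀ hr0 hr1)
  simp only [measureReal_def]
  rw [h, Measure.add_apply, Measure.smul_apply, Measure.smul_apply, smul_eq_mul, smul_eq_mul,
    ENNReal.toReal_add (ENNReal.mul_ne_top ENNReal.ofReal_ne_top (measure_ne_top _ _))
      (ENNReal.mul_ne_top ENNReal.ofReal_ne_top (measure_ne_top _ _)),
    ENNReal.toReal_mul, ENNReal.toReal_ofReal hc0]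
  exact le_add_of_nonneg_right ENNReal.toReal_nonneg

/-- Real form of the split: `μ₀Kⁿ(B) = (1 − rⁿ)·π(B) + rⁿ·ν(B)` for the probability law `ν` of §2. [ours] -/
theorem iterate_bind_indepMH_real_eq (hw : Measurable w) (hw0 : ∀ y, 0 < w y) {x₀ : Ω}
    (hmax : ∀ y, w y ≤ w x₀) [IsProbabilityMeasure (q.withDensity fun y => ENNReal.ofReal (w y))]
    (n : ℕ) (μ₀ : Measure Ω) [IsProbabilityMeasure μ₀] :
    ∃ ν : Measure Ω, IsProbabilityMeasure ν ∧ ∀ {B : Set Ω}, MeasurableSet B →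
      ((fun m : Measure Ω => m.bind (indepMH q w))^[n] μ₀).real B =
        (1 - (1 - (w x₀)⁻¹) ^ n) * (q.withDensity fun y => ENNReal.ofReal (w y)).real B +
          (1 - (w x₀)⁻¹) ^ n * ν.real B := by
  obtain ⟨ν, hν, h⟩ := exists_iterate_bind_indepMH_eq_mixture (q := q) hw hw0 hmax n μ₀
  have hW : 1 ≤ w x₀ := one_le_of_mode (q := q) hmax
  have hr0 : 0 ≤ 1 - (w x₀)⁻¹ := sub_nonneg.2 (inv_le_one_of_one_le₀ hW)
  have hr1 : 1 - (w x₀)⁻¹ ≤ 1 := sub_le_self _ (inv_nonneg.mpr (hw0 x₀).le)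
  have hc0 : 0 ≤ 1 - (1 - (w x₀)⁻¹) ^ n := sub_nonneg.2 (pow_le_one₀ hr0 hr1)
  refine ⟨ν, hν, fun {B} hB => ?_⟩
  simp only [measureReal_def]
  rw [h, Measure.add_apply, Measure.smul_apply, Measure.smul_apply, smul_eq_mul, smul_eq_mul,
    ENNReal.toReal_add (ENNReal.mul_ne_top ENNReal.ofReal_ne_top (measure_ne_top _ _))
      (ENNReal.mul_ne_top ENNReal.ofReal_ne_top (measure_ne_top _ _)),
    ENNReal.toReal_mul, ENNReal.toReal_mul, ENNReal.toReal_ofReal hc0, ENNReal.toReal_ofReal (pow_nonneg hr0 n)]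

/-- **THE UPPER ENVELOPE**: `μ₀Kⁿ(B) ≤ (1 − rⁿ)·π(B) + rⁿ`. [ours] -/
theorem iterate_bind_indepMH_real_le (hw : Measurable w) (hw0 : ∀ y, 0 < w y) {x₀ : Ω}
    (hmax : ∀ y, w y ≤ w x₀) [IsProbabilityMeasure (q.withDensity fun y => ENNReal.ofReal (w y))]
    (n : ℕ) (μ₀ : Measure Ω) [IsProbabilityMeasure μ₀] {B : Set Ω} (hB : MeasurableSet B) :
    ((fun m : Measure Ω => m.bind (indepMH q w))^[n] μ₀).real B ≤
      (1 - (1 - (w x₀)⁻¹) ^ n) * (q.withDensity fun y => ENNReal.ofReal (w y)).real B + (1 - (w x₀)⁻¹) ^ n := by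
  obtain ⟨ν, hν, h⟩ := iterate_bind_indepMH_real_eq (q := q) hw hw0 hmax n μ₀
  have hW : 1 ≤ w x₀ := one_le_of_mode (q := q) hmax
  have hr0 : 0 ≤ 1 - (w x₀)⁻¹ := sub_nonneg.2 (inv_le_one_of_one_le₀ hW)
  rw [h hB]
  have : (1 - (w x₀)⁻¹) ^ n * ν.real B ≤ (1 - (w x₀)⁻¹) ^ n * 1 :=
    mul_le_mul_of_nonneg_left measureReal_le_one (pow_nonneg hr0 n)
  linarith

/-- **SIGNED DEVIATION FROM THE TARGET**: `μ₀Kⁿ(B) − π(B) ∈ [−rⁿ·π(B), rⁿ·(1 − π(B))]` for every start. [ours] -/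
theorem iterate_bind_indepMH_real_sub_mem_Icc (hw : Measurable w) (hw0 : ∀ y, 0 < w y) {x₀ : Ω}
    (hmax : ∀ y, w y ≤ w x₀) [IsProbabilityMeasure (q.withDensity fun y => ENNReal.ofReal (w y))]
    (n : ℕ) (μ₀ : Measure Ω) [IsProbabilityMeasure μ₀] {B : Set Ω} (hB : MeasurableSet B) :
    ((fun m : Measure Ω => m.bind (indepMH q w))^[n] μ₀).real B -
        (q.withDensity fun y => ENNReal.ofReal (w y)).real B ∈
      Set.Icc (-((1 - (w x₀)⁻¹) ^ n * (q.withDensity fun y => ENNReal.ofReal (w y)).real B))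
        ((1 - (w x₀)⁻¹) ^ n * (1 - (q.withDensity fun y => ENNReal.ofReal (w y)).real B)) := by
  have h1 := iterate_bind_indepMH_real_ge (q := q) hw hw0 hmax n μ₀ B
  have h2 := iterate_bind_indepMH_real_le (q := q) hw hw0 hmax n μ₀ hB
  constructor <;> nlinarith

/-- **`|μ₀Kⁿ(B) − π(B)| ≤ rⁿ·max(π(B), 1 − π(B))`** — the Doeblin rate with the exact constant, from every start,
with the larger of the two one-sided slacks. [ours] -/
theorem iterate_bind_indepMH_real_sub_abs_le (hw : Measurable w) (hw0 : ∀ y, 0 < w y) {x₀ : Ω}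
    (hmax : ∀ y, w y ≤ w x₀) [IsProbabilityMeasure (q.withDensity fun y => ENNReal.ofReal (w y))]
    (n : ℕ) (μ₀ : Measure Ω) [IsProbabilityMeasure μ₀] {B : Set Ω} (hB : MeasurableSet B) :
    |((fun m : Measure Ω => m.bind (indepMH q w))^[n] μ₀).real B -
        (q.withDensity fun y => ENNReal.ofReal (w y)).real B| ≤
      (1 - (w x₀)⁻¹) ^ n * max ((q.withDensity fun y => ENNReal.ofReal (w y)).real B)
        (1 - (q.withDensity fun y => ENNReal.ofReal (w y)).real B) := by
  obtain ⟨h1, h2⟩ := iterate_bind_indepMH_real_sub_mem_Icc (q := q) hw hw0 hmax n μ₀ hB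
  have hW : 1 ≤ w x₀ := one_le_of_mode (q := q) hmax
  have hr0 : 0 ≤ (1 - (w x₀)⁻¹) ^ n := pow_nonneg (sub_nonneg.2 (inv_le_one_of_one_le₀ hW)) n
  rw [abs_le]
  constructor
  · have := mul_le_mul_of_nonneg_left (le_max_left ((q.withDensity fun y => ENNReal.ofReal (w y)).real B)
      (1 - (q.withDensity fun y => ENNReal.ofReal (w y)).real B)) hr0
    linarith
  · exact h2.trans (mul_le_mul_of_nonneg_left (le_max_right _ _) hr0)

/-! ## §4 Observables from every start -/

/-- **EVERY OBSERVABLE FROM EVERY START**: for measurable `f` with `a ≤ f ≤ b`,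
`E_{μ₀}[f(X_n)] − π(f) ∈ [rⁿ·(a − π(f)), rⁿ·(b − π(f))]`. [ours] -/
theorem integral_iterate_bind_indepMH_mem_Icc (hw : Measurable w) (hw0 : ∀ y, 0 < w y) {x₀ : Ω}
    (hmax : ∀ y, w y ≤ w x₀) [IsProbabilityMeasure (q.withDensity fun y => ENNReal.ofReal (w y))]
    (n : ℕ) (μ₀ : Measure Ω) [IsProbabilityMeasure μ₀] {f : Ω → ℝ} (hf : Measurable f) {a b : ℝ}
    (ha : ∀ x, a ≤ f x) (hb : ∀ x, f x ≤ b) :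
    ∫ x, f x ∂((fun m : Measure Ω => m.bind (indepMH q w))^[n] μ₀) -
        ∫ x, f x ∂(q.withDensity fun y => ENNReal.ofReal (w y)) ∈
      Set.Icc ((1 - (w x₀)⁻¹) ^ n * (a - ∫ x, f x ∂(q.withDensity fun y => ENNReal.ofReal (w y))))
        ((1 - (w x₀)⁻¹) ^ n * (b - ∫ x, f x ∂(q.withDensity fun y => ENNReal.ofReal (w y)))) := by
  haveI : Fact (Measurable w) := ⟨hw⟩
  obtain ⟨ν, hν, h⟩ := exists_iterate_bind_indepMH_eq_mixture (q := q) hw hw0 hmax n μ₀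
  set π : Measure Ω := q.withDensity fun y => ENNReal.ofReal (w y) with hπ
  have hW : 1 ≤ w x₀ := one_le_of_mode (q := q) hmax
  have hr0 : 0 ≤ 1 - (w x₀)⁻¹ := sub_nonneg.2 (inv_le_one_of_one_le₀ hW)
  have hr1 : 1 - (w x₀)⁻¹ ≤ 1 := sub_le_self _ (inv_nonneg.mpr (hw0 x₀).le)
  have hc0 : 0 ≤ 1 - (1 - (w x₀)⁻¹) ^ n := sub_nonneg.2 (pow_le_one₀ hr0 hr1)
  have hC : ∀ x, |f x| ≤ max |a| |b| := fun x =>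
    abs_le_max_abs_abs (ha x) (hb x)
  have hfi : ∀ (m : Measure Ω) [IsProbabilityMeasure m], Integrable f m := fun m _ =>
    Summit.Ventures.LatticeQCDFlow.Scoring.integrable_of_bounded m hf hC
  rw [h, integral_add_measure ((hfi π).smul_measure ENNReal.ofReal_ne_top)
      ((hfi ν).smul_measure ENNReal.ofReal_ne_top),
    integral_smul_measure, integral_smul_measure, ENNReal.toReal_ofReal hc0,
    ENNReal.toReal_ofReal (pow_nonneg hr0 n), smul_eq_mul, smul_eq_mul]
  have hνa : a ≤ ∫ x, f x ∂ν := by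
    have := integral_mono (integrable_const a) (hfi ν) ha
    rwa [integral_const, probReal_univ, one_smul] at this
  have hνb : ∫ x, f x ∂ν ≤ b := by
    have := integral_mono (hfi ν) (integrable_const b) hb
    rwa [integral_const, probReal_univ, one_smul] at this
  constructor <;> nlinarith [pow_nonneg hr0 n]

/-- **`|E_{μ₀}[f(X_n)] − π(f)| ≤ rⁿ·(b − a)`** for `a ≤ f ≤ b`, from every start (the cold start gives exactly
`rⁿ·|f(x₀) − π(f)|`, GEN-31). [ours] -/
theorem integral_iterate_bind_indepMH_abs_le (hw : Measurable w) (hw0 : ∀ y, 0 < w y) {x₀ : Ω}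
    (hmax : ∀ y, w y ≤ w x₀) [IsProbabilityMeasure (q.withDensity fun y => ENNReal.ofReal (w y))]
    (n : ℕ) (μ₀ : Measure Ω) [IsProbabilityMeasure μ₀] {f : Ω → ℝ} (hf : Measurable f) {a b : ℝ}
    (ha : ∀ x, a ≤ f x) (hb : ∀ x, f x ≤ b) :
    |∫ x, f x ∂((fun m : Measure Ω => m.bind (indepMH q w))^[n] μ₀) -
        ∫ x, f x ∂(q.withDensity fun y => ENNReal.ofReal (w y))| ≤ (1 - (w x₀)⁻¹) ^ n * (b - a) := by
  obtain ⟨h1, h2⟩ := integral_iterate_bind_indepMH_mem_Icc (q := q) hw hw0 hmax n μ₀ hf ha hb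
  haveI : Fact (Measurable w) := ⟨hw⟩
  set π : Measure Ω := q.withDensity fun y => ENNReal.ofReal (w y) with hπ
  have hW : 1 ≤ w x₀ := one_le_of_mode (q := q) hmax
  have hr0 : 0 ≤ (1 - (w x₀)⁻¹) ^ n := pow_nonneg (sub_nonneg.2 (inv_le_one_of_one_le₀ hW)) n
  have hC : ∀ x, |f x| ≤ max |a| |b| := fun x => abs_le_max_abs_abs (ha x) (hb x)
  have hfi : Integrable f π := Summit.Ventures.LatticeQCDFlow.Scoring.integrable_of_bounded π hf hC
  have hπa : a ≤ ∫ x, f x ∂π := by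
    have := integral_mono (integrable_const a) hfi ha
    rwa [integral_const, probReal_univ, one_smul] at this
  have hπb : ∫ x, f x ∂π ≤ b := by
    have := integral_mono hfi (integrable_const b) hb
    rwa [integral_const, probReal_univ, one_smul] at this
  rw [abs_le]
  constructor <;> nlinarith

end Summit.Ventures.LatticeQCDFlow.Exactness

end
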